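import Summits.ABC.IUTFork.Joshi.TestVolumeDictionaryGenuinePow
import Summits.ABC.IUTFork.Joshi.TestGenuinePinsAnyQIdele
import Summits.ABC.IUTFork.Cor312PilotIdelesPrProfile
import HarnessLib

/-!
# TEST (R-J row Y-08): at EVERY bad prime of the certificate setting of record `Thm311.Real.settingPrVolSharp`, and for EVERY
# q-idele family, Joshi's hull-level volume dictionary is EQUIVALENT to the coincidence «Σ_j μ^log(ⁿ˒°𝒰_{j,p}) = 0» (kernel; located)

PROOF-ONLY test file of the abc-iut cell, block E / rescue sub-cell R-J «Joshi Y-discharge census» (rung LADDER-ABC:A2.RESCUE.J;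
seat abc-iut-E-t57, gen 5; row Y-08 `Joshi.VolumeDictionary` of `plan/E/R-J/Y-CENSUS.tsv`, E-plan ruling 2026-08-26T14:00:15Z).
Sequel of this seat's `Joshi/TestVolumeDictionaryGenuine.lean` (p451059) and `Joshi/TestVolumeDictionaryGenuinePow.lean` (p453351:
the real-spec `Q̄_p` model `Model.prototypeDatumPowAt`, `log|ξ|_0 = −s·log p` for every `s > 0`, root tower, `|Θ̃|_B = 1`;
`exists_volumeDictionary_iff_hullSum_eq_zero_real`), and COMPLEMENT of abc-iut-E-t3's `Joshi/TestThetaValuesLocusDictionaryGenuine.lean`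
(p453693: at the same setting, `VolumeDictionary` is KERNEL-FALSE for every prototype datum at `∞` and at the primes carrying no bad
place, and for every ROOT-TOWER datum at the odd unramified bad primes — `not_volumeDictionary_settingPrVolSharp_of_not_wild`; residual
= the wild bad primes `p ∣ 2·disc(F)`, where Y_vol was LOCATED as this seat's coincidence «hull-sum `= 0`»). THIS FILE makes that
location a KERNEL BICONDITIONAL at the genuine setting: at EVERY prime `p` whose q-pilot packet contribution is negative — under
abc-iut-c312-7's realising hypothesis `htq` exactly the primes carrying a bad place, wild or not — and for EVERY q-idele family `tq`
(so under print's `htq` AND Joshi's `htqJ` alike), SOME norm exponent `s` gives a volume dictionary from the real-spec model datum over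
`Q̄_p` iff `H(p) := Σ_{j ∈ 𝔽_l^⋇} μ^log(ⁿ˒°𝒰_{j,p}) = 0`; and every prototype datum with root tower and `|Θ̃|_B ≤ 1` admitting a
dictionary at ANY place forces the hull-sum there to vanish. Consumed BY NAME, nothing recomputed: abc-iut-E-t4 lineage's
`qLocal_settingPrVolSharp_inr_labelIndep` (`TestGenuinePinsAnyQIdele`: the q-contribution at `(j, p)` does not read `j`, for every
`tq`), abc-iut-c312-7's `qLocal_settingPrVolSharp_neg_iff` (`Cor312PilotIdelesPrProfile`: under `htq`, `< 0` iff a place of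
`Supp(𝔮)` lies over `p`). Source on the Joshi side: K. Joshi, arXiv:2303.01662 v3 = [J-IIp] (`paper:arxiv-2303.01662`, bib
`Joshi2023ATS2Local`; Def. 8.3.1 p. 24 l. 9–19, §8.7 p. 25 l. 28 – p. 26 l. 2, Thm. 9.2.1 p. 27 l. 3–6, §9.3 (9.3.1)–(9.3.2) p. 29
l. 7–40), UNREFEREED, rejected by the IUT author [Mochizuki2024JoshiReport], accepted by neither side of the dispute (D-0012).
FRAMING: locates / conditionally verifies; no abc claim; no side taken on [IUTchIII] Cor. 3.12 or on any author; typed ≠ proved ≠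
endorsed; an instance is not an endorsement. `S := Cor312Vol.PilotKummerIndRelated` occurs nowhere below.

## What is shown (kernel), writing `P♯` for the sharp setting

* `exists_volumeDictionary_settingPrVolSharp_inr_iff` — for EVERY q-idele family, at a prime with negative q-contribution:
  `(∃ s > 0, VolumeDictionary (Model.prototypeDatumPowAt p (thetaIndex X) s) P♯ p) ⟺ H(p) = 0`;
* `exists_volumeDictionary_settingPrVolSharp_inr_iff_of_mem` — under `htq`: the same at every prime carrying a place of `Supp(𝔮)`;
* `hullSum_settingPrVolSharp_eq_zero_of_volumeDictionary` — every datum with root tower and `|Θ̃|_B ≤ 1`: a dictionary at `v_ℚ`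
  forces `H(v_ℚ) = 0` (p451059, restated at `P♯`);
* `volumeDictionary_settingPrVolSharp_decided_of_mem` — the two halves packaged: Y_vol at a bad prime of the genuine setting IS the
  measure-zero coincidence `H(p) = 0` on OUR side, no more and no less (for the honest [J-IIp] class).
Reading (neutral): with p453693 this completes Y-08's place-by-place decision at `settingPrVolSharp` — FALSE off the bad primes and at
the odd unramified bad primes (E-t3), and ⟺ `H(p) = 0` at every bad prime (here); whether `H(p) = 0` can occur at a wild bad prime
is a question about OUR packet-hull volumes (abc-iut-w5-d082's window `hullGlued_thetaLocal_window_settingPrVolSharp`, R-W's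
WINDOW-TABLE), not about Joshi's construction. [claim: Joshi2023ATS2Local, status: disputed] [cite: DupuyHilado2025, §3.3, §3.9, Thm. 3.10.1]
-/

noncomputable section

open Set Function NumberField IsDedekindDomain

namespace Summit.ABC.IUTFork.Joshi

open Thm311 Thm311.Real Cor312 Cor312Vol Literature.IUT.LogThetaLattice Literature.IUT.LogVolume Literature.IUT.HodgeTheaters

section GenuineSharp

variable {F : Type} [Field F] [NumberField F] (X : PilotData F) {logv : PadicLogs F} (hlog : LogvAnalytic logv)
  (M : Type) [Field M] [NumberField M]
  (archPk : ∀ (j : (thetaIndex X).Label) (vQ : (thetaIndex X).VQ), Set ((logShellsDH X logv).Packet j vQ))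
  (archSub : ∀ (j : (thetaIndex X).Label) (v : (thetaIndex X).V),
    Set ((logShellsDH X logv).Packet j ((thetaIndex X).over v)))
  (Ψ : ℤ → ∀ v : (thetaIndex X).V, v ∈ (thetaIndex X).Vbad → Set ((logShellsDH X logv).StarPacket v))
  (act : ℤ → ∀ v : (thetaIndex X).V, v ∈ (thetaIndex X).Vbad →
    (logShellsDH X logv).StarPacket v → Module.End ℚ ((logShellsDH X logv).StarPacket v))
  (Mmod : ℤ → ∀ j : (thetaIndex X).LabelStar, Set ((logShellsDH X logv).GlobalPacket j.1))
  (region : ℤ → ∀ j : (thetaIndex X).LabelStar, FinDivisor M → ∀ vQ : (thetaIndex X).VQ,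
    Set ((logShellsDH X logv).Packet j.1 vQ))
  (n : ℤ) {HT : Type} {LogLink : HT → HT → Type} {IsFull : ∀ {s t : HT}, LogLink s t → Prop}
  (lat : LGPGaussianLogThetaLattice LogLink IsFull)
  {Frd : Type} {IsoF : Frd → Frd → Type} {Ob : Frd → Type} {realify : Frd → Frd} {Strip : Type}
  {IsoS : Strip → Strip → Type} {Mv : ∀ v : (thetaIndex X).V, v ∈ (thetaIndex X).Vbad → Type}
  [∀ v h, Monoid (Mv v h)]
  (sig : GlobalLGPFrobenioidSignature (thetaIndex X).lstar (thetaIndex X).V (· ∈ (thetaIndex X).Vbad)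
    Frd IsoF Ob realify Strip IsoS Mv)
  (split : SplittingMonoids Mv) {ObΔ : Type} {N : ∀ v : (thetaIndex X).V, v ∈ (thetaIndex X).Vbad → Type}
  [∀ v h, Monoid (N v h)] (qData : QPilotData ObΔ N)
  (t : ∀ (pp : Nat.Primes) (_ : Fin X.lstar) (x : (thetaIndex X).Fibre (.inr pp)),
    haveI : Fact (pp : ℕ).Prime := ⟨pp.2⟩; kOf X pp.1 x)
  (tq : ∀ (pp : Nat.Primes) (x : (thetaIndex X).Fibre (.inr pp)), haveI : Fact (pp : ℕ).Prime := ⟨pp.2⟩; kOf X pp.1 x)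
  {F' B E0 : Type} [Field F'] [CommRing B] [Field E0] {Y : Type} {K : Y → Type} [∀ y, Field (K y)] {G : Type}

/-! ## Primes with a negative q-contribution (every bad prime): dictionary ⟺ `H(p) = 0` -/

/-- **At a prime `p` with NEGATIVE q-contribution — for EVERY q-idele family — SOME norm exponent `s` gives a volume dictionary
from the real-spec model datum over `Q̄_p` (p453351 `Model.prototypeDatumPowAt`, `ℓ⋆ := X.lstar`, `log|ξ|_0 = −s·log p`, root
tower, `|Θ̃|_B = 1`) iff the hull-sum `H(p)` VANISHES** (label-independence of the q-contribution: abc-iut-E-t4 lineage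
`qLocal_settingPrVolSharp_inr_labelIndep`; criterion: p453351 `exists_volumeDictionary_iff_hullSum_eq_zero_real`).
[claim: Joshi2023ATS2Local, status: disputed] [cite: DupuyHilado2025, §3.9] -/
theorem exists_volumeDictionary_settingPrVolSharp_inr_iff (htq0 : ∀ pp x, tq pp x ≠ 0)
    (htq1 : ∀ (pp : Nat.Primes) (x : (thetaIndex X).Fibre (.inr pp)),
      haveI : Fact (pp : ℕ).Prime := ⟨pp.2⟩; placeOf X pp.1 x ∉ X.S → ‖tq pp x‖ = 1)
    (pp : Nat.Primes) [Fact (pp : ℕ).Prime] (i₀ : Fin (thetaIndex X).lstar)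
    (hneg : (settingPrVolSharp X hlog M archPk archSub Ψ act Mmod region n lat sig split qData tq t htq0 htq1).qLocal
      (Setting.labelSucc i₀) (.inr pp) < 0) :
    (∃ (s : ℝ) (hs : 0 < s), VolumeDictionary (Model.prototypeDatumPowAt (pp : ℕ) (thetaIndex X) s hs)
        (settingPrVolSharp X hlog M archPk archSub Ψ act Mmod region n lat sig split qData tq t htq0 htq1) (.inr pp)) ↔
      ∑ i : Fin (thetaIndex X).lstar,
        ((situationPrVol X hlog M archPk archSub Ψ act Mmod region).D
          (settingPrVolSharp X hlog M archPk archSub Ψ act Mmod region n lat sig split qData tq t htq0 htq1).n).logvol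
          (Setting.labelSucc i) (.inr pp)
          ((settingPrVolSharp X hlog M archPk archSub Ψ act Mmod region n lat sig split qData tq t htq0 htq1).thetaHull
            (Setting.labelSucc i) (.inr pp)) = 0 :=
  exists_volumeDictionary_iff_hullSum_eq_zero_real (pp : ℕ) _ (Sum.inr pp) hneg fun i =>
    qLocal_settingPrVolSharp_inr_labelIndep X hlog M archPk archSub Ψ act Mmod region n lat sig split qData t tq htq0 htq1
      (Setting.labelSucc i) (Setting.labelSucc i₀) pp

/-- **… and EVERY prototype datum with a root tower and `|Θ̃|_B ≤ 1` admitting a dictionary at `p` forces `H(p) = 0`** (p451059,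
restated at the sharp setting; no hypothesis on the ideles). [claim: Joshi2023ATS2Local, status: disputed] -/
theorem hullSum_settingPrVolSharp_eq_zero_of_volumeDictionary (htq0 : ∀ pp x, tq pp x ≠ 0)
    (htq1 : ∀ (pp : Nat.Primes) (x : (thetaIndex X).Fibre (.inr pp)),
      haveI : Fact (pp : ℕ).Prime := ⟨pp.2⟩; placeOf X pp.1 x ∉ X.S → ‖tq pp x‖ = 1)
    {J : PrototypeDatum F' B E0 Y K G} (vQ₀ : (thetaIndex X).VQ)
    (D : VolumeDictionary J (settingPrVolSharp X hlog M archPk archSub Ψ act Mmod region n lat sig split qData tq t htq0 htq1) vQ₀)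
    (r : J.RootTower) (hJ : J.size J.thetaLocus ≤ 1) :
    ∑ i : Fin (thetaIndex X).lstar,
        ((situationPrVol X hlog M archPk archSub Ψ act Mmod region).D
          (settingPrVolSharp X hlog M archPk archSub Ψ act Mmod region n lat sig split qData tq t htq0 htq1).n).logvol
          (Setting.labelSucc i) vQ₀
          ((settingPrVolSharp X hlog M archPk archSub Ψ act Mmod region n lat sig split qData tq t htq0 htq1).thetaHull
            (Setting.labelSucc i) vQ₀) = 0 :=
  hullSum_eq_zero_of_volumeDictionary_of_size_le_one D r hJ

/-- **Under abc-iut-c312-7's realising hypothesis `htq` the negative-contribution primes are exactly those under `S`**: at a prime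
`p` with a place of `Supp(𝔮)` above, SOME `s` gives a dictionary from the real-spec model datum iff `H(p) = 0`.
[claim: Joshi2023ATS2Local, status: disputed] [cite: DupuyHilado2025, §3.3, §3.9, Thm. 3.10.1] -/
theorem exists_volumeDictionary_settingPrVolSharp_inr_iff_of_mem (htq0 : ∀ pp x, tq pp x ≠ 0)
    (htq1 : ∀ (pp : Nat.Primes) (x : (thetaIndex X).Fibre (.inr pp)),
      haveI : Fact (pp : ℕ).Prime := ⟨pp.2⟩; placeOf X pp.1 x ∉ X.S → ‖tq pp x‖ = 1)
    (htq : ∀ (pp : Nat.Primes) (x : (thetaIndex X).Fibre (.inr pp)),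
      haveI : Fact (pp : ℕ).Prime := ⟨pp.2⟩
      Real.log ‖tq pp x‖ = -(X.qPilot (placeOf X pp.1 x)) * logNorm F (placeOf X pp.1 x) /
        localDegree F (placeOf X pp.1 x))
    (pp : Nat.Primes) [Fact (pp : ℕ).Prime] (hS : ∃ v ∈ placesOver F pp, v ∈ X.S) :
    (∃ (s : ℝ) (hs : 0 < s), VolumeDictionary (Model.prototypeDatumPowAt (pp : ℕ) (thetaIndex X) s hs)
        (settingPrVolSharp X hlog M archPk archSub Ψ act Mmod region n lat sig split qData tq t htq0 htq1) (.inr pp)) ↔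
      ∑ i : Fin (thetaIndex X).lstar,
        ((situationPrVol X hlog M archPk archSub Ψ act Mmod region).D
          (settingPrVolSharp X hlog M archPk archSub Ψ act Mmod region n lat sig split qData tq t htq0 htq1).n).logvol
          (Setting.labelSucc i) (.inr pp)
          ((settingPrVolSharp X hlog M archPk archSub Ψ act Mmod region n lat sig split qData tq t htq0 htq1).thetaHull
            (Setting.labelSucc i) (.inr pp)) = 0 :=
  exists_volumeDictionary_settingPrVolSharp_inr_iff X hlog M archPk archSub Ψ act Mmod region n lat sig split qData t tq htq0 htq1 pp
    ⟨0, lt_of_lt_of_le two_pos (thetaIndex X).two_le_lstar⟩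
    ((qLocal_settingPrVolSharp_neg_iff X hlog M archPk archSub Ψ act Mmod region n lat sig split qData t tq htq0 htq1 htq _ pp).2 hS)

/-- **Y-08 at a bad prime of the genuine setting, DECIDED as a coincidence (both halves, honest class)**: under abc-iut-c312-7's
realising hypothesis `htq`, at every prime `p` carrying a place of `Supp(𝔮)` (wild or not) and for the q-idele family of the setting:
(a) EVERY prototype datum with a root tower and `|Θ̃|_B ≤ 1` that admits a volume dictionary at `p` forces `H(p) = 0`; (b) if
`H(p) = 0`, SOME norm exponent `s` gives a volume dictionary from the real-spec model datum over `Q̄_p`. So Joshi's Y_vol there is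
neither supplied nor excluded by his typed construction: it is the condition `H(p) = 0` on OUR packet hulls.
[claim: Joshi2023ATS2Local, status: disputed] [cite: DupuyHilado2025, §3.3, §3.9, Thm. 3.10.1] -/
theorem volumeDictionary_settingPrVolSharp_decided_of_mem (htq0 : ∀ pp x, tq pp x ≠ 0)
    (htq1 : ∀ (pp : Nat.Primes) (x : (thetaIndex X).Fibre (.inr pp)),
      haveI : Fact (pp : ℕ).Prime := ⟨pp.2⟩; placeOf X pp.1 x ∉ X.S → ‖tq pp x‖ = 1)
    (htq : ∀ (pp : Nat.Primes) (x : (thetaIndex X).Fibre (.inr pp)),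
      haveI : Fact (pp : ℕ).Prime := ⟨pp.2⟩
      Real.log ‖tq pp x‖ = -(X.qPilot (placeOf X pp.1 x)) * logNorm F (placeOf X pp.1 x) /
        localDegree F (placeOf X pp.1 x))
    (pp : Nat.Primes) [Fact (pp : ℕ).Prime] (hS : ∃ v ∈ placesOver F pp, v ∈ X.S) :
    (∀ (J : PrototypeDatum F' B E0 Y K G), J.RootTower → J.size J.thetaLocus ≤ 1 →
        VolumeDictionary J (settingPrVolSharp X hlog M archPk archSub Ψ act Mmod region n lat sig split qData tq t htq0 htq1)
          (.inr pp) →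
        ∑ i : Fin (thetaIndex X).lstar,
          ((situationPrVol X hlog M archPk archSub Ψ act Mmod region).D
            (settingPrVolSharp X hlog M archPk archSub Ψ act Mmod region n lat sig split qData tq t htq0 htq1).n).logvol
            (Setting.labelSucc i) (.inr pp)
            ((settingPrVolSharp X hlog M archPk archSub Ψ act Mmod region n lat sig split qData tq t htq0 htq1).thetaHull
              (Setting.labelSucc i) (.inr pp)) = 0) ∧
      (∑ i : Fin (thetaIndex X).lstar,
          ((situationPrVol X hlog M archPk archSub Ψ act Mmod region).D
            (settingPrVolSharp X hlog M archPk archSub Ψ act Mmod region n lat sig split qData tq t htq0 htq1).n).logvol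
            (Setting.labelSucc i) (.inr pp)
            ((settingPrVolSharp X hlog M archPk archSub Ψ act Mmod region n lat sig split qData tq t htq0 htq1).thetaHull
              (Setting.labelSucc i) (.inr pp)) = 0 →
        ∃ (s : ℝ) (hs : 0 < s), VolumeDictionary (Model.prototypeDatumPowAt (pp : ℕ) (thetaIndex X) s hs)
          (settingPrVolSharp X hlog M archPk archSub Ψ act Mmod region n lat sig split qData tq t htq0 htq1) (.inr pp)) :=
  ⟨fun _ r hJ D => hullSum_eq_zero_of_volumeDictionary_of_size_le_one D r hJ,
    fun hH => (exists_volumeDictionary_settingPrVolSharp_inr_iff_of_mem X hlog M archPk archSub Ψ act Mmod region n lat sig split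
      qData t tq htq0 htq1 htq pp hS).2 hH⟩

/-! ## Appendix (rider R1 of the Y-08 double-read, abc-iut-E-t6 2026-08-26T16:34:48Z): the bad-prime packaging under JOSHI's
q-normalisation `htqJ` as well -/

/-- **Under Joshi's q-normalisation `htqJ` (`t_q` realises `ℓ⋆²·P_q = P_{Θ,ℓ⋆}`, abc-iut-E-t4 lineage p434945) the negative-contribution
primes are again exactly those carrying a place of `Supp(𝔮)`**: there the q-pilot packet contribution is
`−(ℓ⋆²/[F:ℚ])·Σ_{v|p} P_q(v)·log N(v) < 0` (E-t4's `qLocal_settingPrVolSharp_inr_of_realising`, `qSum_neg`), so SOME norm exponent `s`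
gives a volume dictionary from the real-spec model datum over `Q̄_p` iff `H(p) = 0` — the `htqJ` twin of
`exists_volumeDictionary_settingPrVolSharp_inr_iff_of_mem`; the joint row word's «htq / htqJ alike» is thereby packaged under both
normalisations. [claim: Joshi2023ATS2Local, status: disputed] [claim: Joshi2024ATS3, status: disputed]
[cite: DupuyHilado2025, §3.3, §3.9, Thm. 3.10.1] -/
theorem exists_volumeDictionary_settingPrVolSharp_inr_iff_of_mem_htqJ (htq0 : ∀ pp x, tq pp x ≠ 0)
    (htq1 : ∀ (pp : Nat.Primes) (x : (thetaIndex X).Fibre (.inr pp)),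
      haveI : Fact (pp : ℕ).Prime := ⟨pp.2⟩; placeOf X pp.1 x ∉ X.S → ‖tq pp x‖ = 1)
    (htqJ : ∀ (pp : Nat.Primes) (x : (thetaIndex X).Fibre (.inr pp)),
      haveI : Fact (pp : ℕ).Prime := ⟨pp.2⟩
      Real.log ‖tq pp x‖ = -(((X.lstar : ℝ) ^ 2) * X.qPilot (placeOf X pp.1 x)) * logNorm F (placeOf X pp.1 x) /
        localDegree F (placeOf X pp.1 x))
    (pp : Nat.Primes) [Fact (pp : ℕ).Prime] (hS : ∃ v ∈ placesOver F pp, v ∈ X.S) :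
    (∃ (s : ℝ) (hs : 0 < s), VolumeDictionary (Model.prototypeDatumPowAt (pp : ℕ) (thetaIndex X) s hs)
        (settingPrVolSharp X hlog M archPk archSub Ψ act Mmod region n lat sig split qData tq t htq0 htq1) (.inr pp)) ↔
      ∑ i : Fin (thetaIndex X).lstar,
        ((situationPrVol X hlog M archPk archSub Ψ act Mmod region).D
          (settingPrVolSharp X hlog M archPk archSub Ψ act Mmod region n lat sig split qData tq t htq0 htq1).n).logvol
          (Setting.labelSucc i) (.inr pp)
          ((settingPrVolSharp X hlog M archPk archSub Ψ act Mmod region n lat sig split qData tq t htq0 htq1).thetaHull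
            (Setting.labelSucc i) (.inr pp)) = 0 := by
  obtain ⟨v₀, hv₀p, hv₀S⟩ := hS
  refine exists_volumeDictionary_settingPrVolSharp_inr_iff X hlog M archPk archSub Ψ act Mmod region n lat sig split qData t tq htq0
    htq1 pp ⟨0, lt_of_lt_of_le two_pos (thetaIndex X).two_le_lstar⟩ ?_
  rw [qLocal_settingPrVolSharp_inr_of_realising X hlog M archPk archSub Ψ act Mmod region n lat sig split qData t tq htq0 htq1
    (fun v => -(((X.lstar : ℝ) ^ 2) * X.qPilot v)) htqJ]
  have h := qSum_neg X hv₀S pp hv₀p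
  have hl : (0 : ℝ) < (X.lstar : ℝ) ^ 2 := by have := X.two_le_lstar; positivity
  have hsum : (∑ v ∈ placesOver F pp, -(((X.lstar : ℝ) ^ 2) * X.qPilot v) * logNorm F v) =
      (X.lstar : ℝ) ^ 2 * ∑ v ∈ placesOver F pp, -(X.qPilot v) * logNorm F v := by
    rw [Finset.mul_sum]
    exact Finset.sum_congr rfl fun v _ => by ring
  rw [hsum, mul_div_assoc]
  exact mul_neg_of_pos_of_neg hl h

end GenuineSharp

end Summit.ABC.IUTFork.Joshi

end
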